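import Summits.AtomisticToContinuum.HydrodynamicLimit.Theorems.OneFlightGossipEngineEnergyCurrentTailsLevelCensusForwardWindow
import Summits.AtomisticToContinuum.HydrodynamicLimit.Theorems.JParityClosureOddContactSymmetryGibbsInvariance
import Summits.AtomisticToContinuum.HydrodynamicLimit.Theorems.JParityClosureCollisionTightnessSweptTube
import Summits.AtomisticToContinuum.HydrodynamicLimit.Theorems.JParityClosureCollisionTightnessTorusGibbs
import Literature.MathematicalPhysics.KineticTheory.HardSphereCanonicalPairBound
import Literature.Analysis.FluidPDE.HardSphereDynamicsProofs
import HarnessLib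

/-!
# Crux `EnergyCurrentTails` (stmt-AtomisticToContinuum-9235), line `level-census-comparison`:
# the rung-0 collision-flux bound for marks of the PRE-collisional velocities (the incoming-mark engine of stub F2)

Helper file (`--supports stmt-AtomisticToContinuum-9235`) of stub F2 `stub_mergeCeiling`.  Expectation form of
the forward one-window bookkeeping `sum_collision_pre_le_sum_window` of `…LevelCensusForwardWindow` (each
collision assigned to the grid time BEFORE it, whose configuration carries the incoming velocities), its
rung-0 specialisation by the forward statics `exists_windowEvent_fwd`, and the pathwise domination of a
window's guarded velocity-event count by a collision pair sum of an incoming mark along the shifted orbit: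

* `lintegral_le_liminf_of_le_collisionPairSum_fwd` — `∫ f dP ≤ liminf_M M ∫ Σ_{i≠j} 𝟙_{E M i j} A(vᵢ,vⱼ) dP`
  for every `f` dominated on the good set by the collision sum over `(0, τ]` of `A(c.preVel)` (incoming
  velocities of the RECORDS) along the orbit of `Φ_{t₀} z` (flow-invariant law carried by the good set; Fatou,
  stationarity);
* `localGibbsLaw_lintegral_le_of_le_preCollisionMarkSum` (registered helper) — under the homogeneous Gibbs
  law: `∫ f dG_N ≤ 16 τ (N+1)² ε_N² · ∫ ‖v − w‖ A(v, w) dN(u,θ)^{⊗2}`;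
* `collisionSum_Ioc_eq_collisionSum_flow`, `collisionSum_ite_indicator_le_preCollisionMarkSum` — window
  shift and termwise domination.

References: Cercignani–Illner–Pulvirenti 1994, App. 4.A; Gallagher–Saint-Raymond–Texier 2013, Prop. 4.1.1.
-/

noncomputable section

open MeasureTheory Set Filter Topology Function
open scoped ENNReal BigOperators

namespace Summit.AtomisticToContinuum.HydrodynamicLimit.Theorems.EnergyCurrentTailsLevelCensus

open Literature.MathematicalPhysics.KineticTheory Literature.Analysis.FluidPDE
open Literature.Analysis.FunctionSpaces

/-! ### The forward window bound in expectation form -/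

/-- **The FORWARD window bound for collision sums of incoming velocity marks — expectation form.**  Let
`Φ` be a hard-sphere flow over a Hausdorff position space with continuous translations, `P` a law preserved
by every `Φ_t` and carried by the good set, `τ > 0`, `A` an `ℝ≥0∞`-valued mark of two velocities with
`w ↦ A(vᵢ, vⱼ)` measurable, and `E M i j` measurable FORWARD one-window events (containing every
non-overlapping `w` whose pair `(i, j)` reaches contact under a forward free flight of duration `≤ τ/M`).
Then every `f` dominated on the good set by the collision sum over `(0, τ]` of `A` at the INCOMING velocities
`c.preVel` of the records along the orbit of `Φ_{t₀} z` has
`∫ f dP ≤ liminf_M M · ∫ Σ_{i≠j} 𝟙_{E M i j}(w) A(vᵢ, vⱼ) dP` (grid majorant `sum_collision_pre_le_sum_window`,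
Fatou, stationarity). [folklore] -/
theorem lintegral_le_liminf_of_le_collisionPairSum_fwd {d X : Type*} [Fintype d] [MeasureSpace X]
    [TopologicalSpace X] [T2Space X] {G : Geometry d X} (hG : ∀ x : X, Continuous (G.translate x))
    {ε : ℝ} {n : ℕ} (Φ : HardSphereFlow G ε n) (P : Measure (Config n d X))
    (hstat : ∀ t : ℝ, MeasurePreserving (Φ.flow t) P P) (hgood : ∀ᵐ z ∂P, z ∈ Φ.good) {τ : ℝ}
    (hτ : 0 < τ) (A : EuclideanSpace ℝ d × EuclideanSpace ℝ d → ℝ≥0∞)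
    (hAm : ∀ i j : Fin n, Measurable fun w : Config n d X => A ((w i).2, (w j).2))
    (E : ℕ → Fin n → Fin n → Set (Config n d X)) (hEm : ∀ M i j, MeasurableSet (E M i j))
    (hE : ∀ (M : ℕ) (i j : Fin n), i ≠ j → ∀ w ∈ hardSphereDomain G n ε, ∀ t ∈ Icc 0 (τ / M),
      ‖G.sepVec ((freeFlight G t w i).1) ((freeFlight G t w j).1)‖ = ε → w ∈ E M i j)
    (t₀ : ℝ) {f : Config n d X → ℝ≥0∞}
    (hf : ∀ z ∈ Φ.good, f z ≤ Φ.collisionSum (Ioc 0 τ) (fun c => A c.preVel) (Φ.flow t₀ z)) :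
    ∫⁻ z, f z ∂P ≤ liminf (fun M : ℕ => (M : ℝ≥0∞) *
        ∫⁻ w, ∑ i, ∑ j, (if i ≠ j then (E M i j).indicator (fun w => A ((w i).2, (w j).2)) w else 0) ∂P)
      atTop := by
  classical
  set W : ℕ → Config n d X → ℝ≥0∞ := fun M w => ∑ i, ∑ j,
    (if i ≠ j then (E M i j).indicator (fun w => A ((w i).2, (w j).2)) w else 0) with hWdef
  have hWm : ∀ M, Measurable (W M) := fun M =>
    Finset.measurable_sum _ fun i _ => Finset.measurable_sum _ fun j _ => by
      split_ifs; exacts [(hAm i j).indicator (hEm M i j), measurable_const]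
  set SM : ℕ → Config n d X → ℝ≥0∞ := fun M z =>
    ∑ k ∈ Finset.range M, W M (Φ.flow ((k : ℝ) * (τ / M)) z) with hSMdef
  have hSMm : ∀ M, Measurable (SM M) := fun M =>
    Finset.measurable_sum _ fun k _ => (hWm M).comp (Φ.measurable_flow _)
  set Kstar : Config n d X → ℝ≥0∞ := fun z => liminf (fun M => SM M z) atTop with hKdef
  have hKm : Measurable Kstar := Measurable.liminf hSMm
  -- (i) the pathwise bound on the good set (the record's incoming velocities are `reflectVel` of the value)
  have hpath : ∀ w ∈ Φ.good, Φ.collisionSum (Ioc 0 τ) (fun c => A c.preVel) w ≤ Kstar w := by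
    intro w hw
    have hγ := Φ.isTrajectory w hw
    have hfin : (collisionTimes G ε (fun t => Φ.flow t w) ∩ Ioc 0 τ).Finite :=
      hγ.finite_collisionTimes_inter_of_subset_Icc Ioc_subset_Icc_self
    rw [HardSphereFlow.collisionSum_eq_collisionPairSum, Φ.collisionPairSum_eq_finsum_ite hw,
      finsum_mem_eq_finite_toFinset_sum _ hfin]
    obtain ⟨g, hg, hgap⟩ := exists_gap_of_finite (hγ.locFinite 0 τ)
    show _ ≤ liminf (fun M => SM M w) atTop
    refine le_liminf_of_le (h := ?_)
    filter_upwards [eventually_gt_atTop ⌈τ / g⌉₊] with M hM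
    have hM0 : 0 < M := lt_of_le_of_lt (Nat.zero_le _) hM
    have hMg : τ / M < g := by
      have h1 : τ / g < M := (Nat.le_ceil _).trans_lt (by exact_mod_cast hM)
      rw [div_lt_iff₀ hg] at h1
      rw [div_lt_iff₀ (by exact_mod_cast hM0)]
      linarith
    have hgap' : ∀ s ∈ collisionTimes G ε (fun t => Φ.flow t w) ∩ Icc 0 τ,
        ∀ s' ∈ collisionTimes G ε (fun t => Φ.flow t w) ∩ Icc 0 τ, s < s' → τ / M < s' - s :=
      fun s hs s' hs' hlt => hMg.trans_le (hgap s hs s' hs' hlt)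
    exact sum_collision_pre_le_sum_window hγ hG hτ hM0 hgap' hfin (E M) (hE M) A
  -- (ii) the mean of each grid sum (stationarity) and Fatou
  have hmeanM : ∀ M, ∫⁻ z, SM M z ∂P = (M : ℝ≥0∞) * ∫⁻ w, W M w ∂P := by
    intro M
    calc ∫⁻ z, SM M z ∂P = ∑ k ∈ Finset.range M, ∫⁻ z, W M (Φ.flow ((k : ℝ) * (τ / M)) z) ∂P :=
          lintegral_finsetSum _ fun k _ => (hWm M).comp (Φ.measurable_flow _)
      _ = ∑ _k ∈ Finset.range M, ∫⁻ z, W M z ∂P :=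
          Finset.sum_congr rfl fun k _ => (hstat _).lintegral_comp (hWm M)
      _ = (M : ℝ≥0∞) * ∫⁻ w, W M w ∂P := by
          rw [Finset.sum_const, Finset.card_range, nsmul_eq_mul]
  have hmean : ∫⁻ z, Kstar z ∂P ≤ liminf (fun M : ℕ => (M : ℝ≥0∞) * ∫⁻ w, W M w ∂P) atTop := by
    refine (lintegral_liminf_le hSMm).trans (le_of_eq ?_)
    exact congrArg (fun u : ℕ → ℝ≥0∞ => liminf u atTop) (funext hmeanM)
  -- (iii) a.e. domination by `K⋆ ∘ Φ_{t₀}` and stationarity once more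
  have hae : ∀ᵐ z ∂P, f z ≤ Kstar (Φ.flow t₀ z) := by
    filter_upwards [hgood] with z hz
    exact (hf z hz).trans (hpath _ (Φ.mapsTo_good t₀ hz))
  calc ∫⁻ z, f z ∂P ≤ ∫⁻ z, Kstar (Φ.flow t₀ z) ∂P := lintegral_mono_ae hae
    _ = ∫⁻ z, Kstar z ∂P := (hstat t₀).lintegral_comp hKm
    _ ≤ _ := hmean

/-! ### The rung-0 specialisation -/

/-- **Registered helper `localGibbsLaw_lintegral_le_of_le_preCollisionMarkSum` — rung-0 collision-flux
bound for marks of the PRE-collisional velocities (expectation form).**  For a small reduced density `σ`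
(`SmallDensity uniformProfile σ`: the Ruelle-type pair bound `posGibbs_pairEvent_le`), constant profiles
`a, θ > 0`, `u`, `N ≥ 1`, a flow `Φ` of `N + 1` spheres of diameter `ε_N = hsDiameter σ N` on `𝕋³`,
`τ > 0` and a measurable `ℝ≥0∞`-valued mark `A` of two velocities: every `f` dominated on the good set by
the collision sum over `(0, τ]` of `A` at the incoming velocities `c.preVel` of the records along the orbit of
`Φ_{t₀} z` has `∫ f dG_N ≤ 16 τ (N+1)² ε_N² · ∫ ‖w − v‖ A(v, w) dN(u,θ)^{⊗2}` under the homogeneous Gibbs law `G_N`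
(invariant under every flow map, `measurePreserving_flow_localGibbsLaw_const`; swept tubes
`exists_sweptTube`, lifts `volume_setOf_exists_reprSym_add_latticeVec_mem_le`). [folklore] -/
theorem localGibbsLaw_lintegral_le_of_le_preCollisionMarkSum : ∀ {σ : ℝ},
    SmallDensity uniformProfile σ → ∀ {a θ : ℝ}, 0 < a → 0 < θ → ∀ (u : V3) {N : ℕ}, 1 ≤ N →
    ∀ (Φ : HardSphereFlow (Torus.geometry (Fin 3)) (hsDiameter σ N) (N + 1)) {τ : ℝ}, 0 < τ →
    ∀ {A : V3 × V3 → ℝ≥0∞}, Measurable A → ∀ (t₀ : ℝ) {f : Config (N + 1) (Fin 3) T3 → ℝ≥0∞},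
    (∀ z ∈ Φ.good, f z ≤ Φ.collisionSum (Ioc 0 τ) (fun c => A c.preVel) (Φ.flow t₀ z)) →
    ∫⁻ z, f z ∂(localGibbsLaw σ (fun _ => a) (fun _ => u) (fun _ => θ) N Φ) ≤
      ENNReal.ofReal (16 * τ * ((N + 1 : ℕ) : ℝ) ^ 2 * hsDiameter σ N ^ 2) *
        ∫⁻ p, ENNReal.ofReal ‖p.2 - p.1‖ * A p ∂((gaussMeasure u θ).prod (gaussMeasure u θ)) := by
  intro σ hsm a θ ha hθ u N hN Φ τ hτ A hAm t₀ f hf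
  classical
  set P := localGibbsLaw σ (fun _ => a) (fun _ => u) (fun _ => θ) N Φ with hPdef
  set I : ℝ≥0∞ := ∫⁻ p, ENNReal.ofReal ‖p.1 - p.2‖ * A p
    ∂((gaussMeasure u θ).prod (gaussMeasure u θ)) with hIdef
  have hI : ∫⁻ p, ENNReal.ofReal ‖p.2 - p.1‖ * A p ∂((gaussMeasure u θ).prod (gaussMeasure u θ)) = I :=
    lintegral_congr fun p => by rw [norm_sub_rev]
  rw [hI]
  have hσ2 : σ ≤ 1 / 2 := hsm.σ_lt_half.le
  have hε : 0 < hsDiameter σ N := hsDiameter_pos hsm.σ_pos N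
  have hG : ∀ x : T3, Continuous ((Torus.geometry (Fin 3)).translate x) := fun x =>
    continuous_const.add Torus.continuous_proj
  have hAm' : ∀ i j : Fin (N + 1), Measurable fun w : Config (N + 1) (Fin 3) T3 =>
      A ((w i).2, (w j).2) :=
    fun i j => hAm.comp ((measurable_pi_apply i).snd.prodMk (measurable_pi_apply j).snd)
  -- the forward window events, for every mesh `τ / M` and every ordered pair
  have hev : ∀ (M : ℕ) (i j : Fin (N + 1)), ∃ E : Set (Config (N + 1) (Fin 3) T3),
      MeasurableSet E ∧
      (i ≠ j → ∀ w ∈ hardSphereDomain (Torus.geometry (Fin 3)) (N + 1) (hsDiameter σ N),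
        ∀ t ∈ Icc 0 (τ / M),
        ‖(Torus.geometry (Fin 3)).sepVec ((freeFlight (Torus.geometry (Fin 3)) t w i).1)
          ((freeFlight (Torus.geometry (Fin 3)) t w j).1)‖ = hsDiameter σ N → w ∈ E) ∧
      (i ≠ j → ∫⁻ w, E.indicator (fun w => A ((w i).2, (w j).2)) w ∂P ≤
        ENNReal.ofReal (16 * hsDiameter σ N ^ 2 * (τ / M)) * I) := by
    intro M i j
    by_cases hij : i ≠ j
    · have hh : 0 ≤ τ / M := div_nonneg hτ.le (Nat.cast_nonneg M)
      obtain ⟨S, hSm, hSvol, hS⟩ := exists_sweptTube hε hh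
      obtain ⟨E, hEm, hEc, hEb⟩ :=
        exists_windowEvent_fwd hσ2 ha hθ u hh hij (fun T hT => posGibbs_pairEvent_le hsm hN hij hT)
          hSm hSvol hS (fun B hB => by
            simpa only [sub_zero] using volume_setOf_exists_reprSym_add_latticeVec_mem_le 0 hB)
      exact ⟨E, hEm, fun _ => hEc, fun _ => hEb Φ A hAm⟩
    · exact ⟨∅, MeasurableSet.empty, fun h => absurd h hij, fun h => absurd h hij⟩
  choose E hEm hEc hEb using hev
  have hgood : ∀ᵐ z ∂P, z ∈ Φ.good := by
    refine mem_ae_iff.2 ?_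
    rw [hPdef, localGibbsLaw_eq]
    exact localGibbsMeasure_absolutelyContinuous σ _ _ _ N Φ Φ.measure_compl_good
  have hgen := lintegral_le_liminf_of_le_collisionPairSum_fwd hG Φ P
    (measurePreserving_flow_localGibbsLaw_const σ a θ u N Φ) hgood hτ A hAm'
    (fun M i j => E M i j) hEm (fun M i j hij => hEc M i j hij) t₀ hf
  -- the mean of one window: the static bound, `(N+1)²` ordered pairs, and `M · (τ/M) = τ`
  have hB : ∀ M : ℕ, (M : ℝ≥0∞) * ∫⁻ w, ∑ i, ∑ j,
      (if i ≠ j then (E M i j).indicator (fun w => A ((w i).2, (w j).2)) w else 0) ∂P ≤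
        ENNReal.ofReal (16 * τ * ((N + 1 : ℕ) : ℝ) ^ 2 * hsDiameter σ N ^ 2) * I := by
    intro M
    rcases Nat.eq_zero_or_pos M with hM0 | hM0
    · subst hM0
      simp only [Nat.cast_zero, zero_mul, zero_le]
    have hM' : (0 : ℝ) < M := by exact_mod_cast hM0
    have hterm : ∀ i j : Fin (N + 1), ∫⁻ w, (if i ≠ j then (E M i j).indicator
        (fun w => A ((w i).2, (w j).2)) w else 0) ∂P ≤
          ENNReal.ofReal (16 * hsDiameter σ N ^ 2 * (τ / M)) * I :=
      fun i j => by split_ifs with hij; exacts [hEb M i j hij, by simp only [lintegral_zero, zero_le]]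
    have hmeas : ∀ i j : Fin (N + 1), Measurable fun w : Config (N + 1) (Fin 3) T3 =>
        (if i ≠ j then (E M i j).indicator (fun w => A ((w i).2, (w j).2)) w else 0) :=
      fun i j => by split_ifs; exacts [(hAm' i j).indicator (hEm M i j), measurable_const]
    calc (M : ℝ≥0∞) * ∫⁻ w, ∑ i, ∑ j,
          (if i ≠ j then (E M i j).indicator (fun w => A ((w i).2, (w j).2)) w else 0) ∂P
        = (M : ℝ≥0∞) * ∑ i, ∑ j, ∫⁻ w,
            (if i ≠ j then (E M i j).indicator (fun w => A ((w i).2, (w j).2)) w else 0) ∂P := by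
          congr 1
          rw [lintegral_finsetSum _ fun i _ => Finset.measurable_sum _ fun j _ => hmeas i j]
          exact Finset.sum_congr rfl fun i _ => lintegral_finsetSum _ fun j _ => hmeas i j
      _ ≤ (M : ℝ≥0∞) * ∑ _i : Fin (N + 1), ∑ _j : Fin (N + 1),
            ENNReal.ofReal (16 * hsDiameter σ N ^ 2 * (τ / M)) * I := by
          gcongr with i _ j _
          exact hterm i j
      _ = ENNReal.ofReal (16 * τ * ((N + 1 : ℕ) : ℝ) ^ 2 * hsDiameter σ N ^ 2) * I := by
          simp only [Finset.sum_const, Finset.card_univ, Fintype.card_fin, nsmul_eq_mul]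
          rw [← ENNReal.ofReal_natCast M, ← ENNReal.ofReal_natCast (N + 1), ← mul_assoc, ← mul_assoc,
            ← mul_assoc, ← ENNReal.ofReal_mul (Nat.cast_nonneg _),
            ← ENNReal.ofReal_mul (by positivity), ← ENNReal.ofReal_mul (by positivity)]
          congr 1
          congr 1
          field_simp
  exact hgen.trans (liminf_le_of_frequently_le' (Frequently.of_forall hB))

/-! ### Pathwise: window shift and termwise domination -/

/-- **Window shift.**  On a good orbit, a collision sum over `(s, s′]` of a functional of the records that
does not read the time stamp equals the collision sum over `(0, s′ − s]` along the orbit of `Φ_s z`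
(group property: the collision times shift by `s`). [folklore] -/
theorem collisionSum_Ioc_eq_collisionSum_flow {d X : Type*} [Fintype d] [MeasureSpace X]
    [TopologicalSpace X] {G : Geometry d X} {ε : ℝ} {n : ℕ} (Φ : HardSphereFlow G ε n)
    {z : Config n d X} (hz : z ∈ Φ.good) (s s' : ℝ) {M : Type*} [AddCommMonoid M]
    (g : HardSphereCollisionRecord d X n → M)
    (hg : ∀ (w : Config n d X) (t t' : ℝ) (i j : Fin n),
      g (HardSphereCollisionRecord.ofConfig G ε w t i j) = g (HardSphereCollisionRecord.ofConfig G ε w t' i j)) :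
    Φ.collisionSum (Ioc s s') g z = Φ.collisionSum (Ioc 0 (s' - s)) g (Φ.flow s z) := by
  rw [HardSphereFlow.collisionSum_eq, HardSphereFlow.collisionSum_eq, collisionSum_eq_collisionPairSum,
    collisionSum_eq_collisionPairSum]
  have hfa : ∀ r, Φ.flow r (Φ.flow s z) = Φ.flow (r + s) z := fun r => (Φ.flow_add r s z hz).symm
  simp only [hfa]
  unfold collisionPairSum
  symm
  refine finsum_mem_eq_of_bijOn (fun r => r + s) ⟨?_, ?_, ?_⟩ fun r _ => ?_
  · rintro r ⟨hr, h0, hr'⟩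
    exact ⟨hr, by linarith, by linarith⟩
  · exact fun r _ r' _ hrr' => by simpa using hrr'
  · rintro t ⟨ht, hts, hts'⟩
    refine ⟨t - s, ⟨?_, by linarith, by linarith⟩, sub_add_cancel t s⟩
    show t - s + s ∈ collisionTimes G ε fun t => Φ.flow t z
    rwa [sub_add_cancel]
  · exact Finset.sum_congr rfl fun p _ => hg _ _ _ _ _

/-- **Pathwise domination of a window's guarded velocity-event count** by the collision sum over `(0, s′ − s]`
of any mark `A ≥ 𝟙_S` of the records' incoming velocities along the orbit of `Φ_s z`. [folklore] -/
theorem collisionSum_ite_indicator_le_preCollisionMarkSum {σ : ℝ} {N : ℕ}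
    (Φ : HardSphereFlow (Torus.geometry (Fin 3)) (hsDiameter σ N) (N + 1))
    {z : Config (N + 1) (Fin 3) T3} (hz : z ∈ Φ.good) (s s' : ℝ) (S : Set ((V3 × V3) × (V3 × V3)))
    {A : V3 × V3 → ℝ≥0∞} (hA : ∀ q ∈ S, 1 ≤ A q.1) :
    Φ.collisionSum (Ioc s s')
        (fun c => if c.fst < c.snd then S.indicator (fun _ => (1 : ℝ≥0∞)) (c.preVel, c.postVel)
          else 0) z ≤
      Φ.collisionSum (Ioc 0 (s' - s)) (fun c => A c.preVel) (Φ.flow s z) := by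
  rw [collisionSum_Ioc_eq_collisionSum_flow Φ hz s s' _ fun _ _ _ _ _ => rfl]
  have hw : Φ.flow s z ∈ Φ.good := Φ.mapsTo_good s hz
  have hfin := Φ.finite_collisionTimes_inter hw (S := Ioc 0 (s' - s)) Ioc_subset_Icc_self
  rw [HardSphereFlow.collisionSum_eq, HardSphereFlow.collisionSum_eq, collisionSum_eq_finset_sum hfin,
    collisionSum_eq_finset_sum hfin]
  refine Finset.sum_le_sum fun t _ => Finset.sum_le_sum fun p _ => ?_
  split_ifs
  · by_cases hq : ((HardSphereCollisionRecord.ofConfig (Torus.geometry (Fin 3)) (hsDiameter σ N)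
        (Φ.flow t (Φ.flow s z)) t p.1 p.2).preVel,
        (HardSphereCollisionRecord.ofConfig (Torus.geometry (Fin 3)) (hsDiameter σ N)
        (Φ.flow t (Φ.flow s z)) t p.1 p.2).postVel) ∈ S
    · rw [indicator_of_mem hq]
      exact hA _ hq
    · rw [indicator_of_notMem hq]
      exact bot_le
  · exact bot_le

end Summit.AtomisticToContinuum.HydrodynamicLimit.Theorems.EnergyCurrentTailsLevelCensus

end
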